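import Mathlib
import Summits.NavierStokesRegularity.NavierStokesRegularity.Theorems.ThreadingFluxAzimuthalCartanConicalSteadyNS
import Summits.NavierStokesRegularity.NavierStokesRegularity.Theorems.ThreadingFluxAzimuthalCartanConicalWitness
import Summits.NavierStokesRegularity.NavierStokesRegularity.Theorems.ThreadingFluxAzimuthalCartanCrossFlowNoAxis
import Summits.NavierStokesRegularity.NavierStokesRegularity.Theorems.ThreadingFluxSilentShellsTwoAxesTools
import HarnessLib

/-!
# Crux `PoloidalLiouville` (stmt-NavierStokesRegularity-1222, wall W1), crux idea «azimuthal-cartan-test» (ns-idea-15 g10):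
# K♯ `PoloidalConicalFlows` BY NAME — the rational conical flow has `curl ≠ 0` and NO symmetry axis (K♯ item 2, part 2)

Support file (`--supports stmt-NavierStokesRegularity-1222`, helper; cell `ns-wall-extremal`, width hand ns-wall-eng-6 g5, 0 kit).
With `Φ = ConicalWitness.potential` (`e^{Φ} = N/D²`, `…ConicalWitness`) and `u = conicalField Φ`, `p = conicalPressure Φ`
(`…ConicalCorrespondence`), on `coneBall = ball (1,1,1) ½`:

* the values at the centre `x₁ = (1,1,1)`: `N = 196`, `D = 14`, `e^{Φ} = 1` (so `h = 0`), `g = u(x₁) = (−108, 36, 72)/49`,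
  `H(x₁) = (1/2401)·[[3204, −1488, 3576], [−1488, 1812, −2088], [3576, −2088, −5016]]`, `Du(x₁) v = H(x₁) v + ⅔⟪g, v⟫ x₁`;
* `curl_conicalField_xOne_ne_zero` — `curl u (x₁) = ⅔ (g × x₁) = (−24, 120, −96)/49 ≠ 0`;
* ★ `noAxis` — no non-zero skew `A` makes `u` infinitesimally `A`-equivariant about `0` on the ball: with `A = w × ·`
  (`SilentShells.TwoAxes.exists_cross_of_skew`) the identity `Du(x₁)[w × x₁] = w × u(x₁)` is three rational linear equations in `w`
  with determinant `5598720/117649 ≠ 0`, so `w = 0` (one rational point suffices; the constant-swirl clause is not needed);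
* ★★★ `poloidalConicalFlows : PoloidalConicalFlows` — K♯ of the sketch/twin (`…AzimuthalCartanDefs` l.299) BY NAME: witnesses
  `V = conicalField Φ`, `p = conicalPressure Φ`, `x₀ = 0`, `x₁ = (1,1,1)`, `ρ = ½`; analyticity, steady NS, unthreadedness and
  `(−1)`-homogeneity from `LiouvilleCone.correspondence` applied to `ConicalWitness.liouvilleCone`.

PLACEMENT (director-ns g19 p100 (2), crit-1 g7 PRICE (3)): the witness is singular exactly on the vertex and the four rays
`{x₂ = 0, 3x₀² = 5x₁²}` (zeros of `N`), and the ball (all coordinates `> ½`) misses them — consistent with Šverák's theorem (a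
`(−1)`-homogeneous solution smooth on ALL of `S²` is Landau, hence axisymmetric): ball-local `(−1)`-homogeneous unthreaded steady flows
need no axis, while on FULL shells they are Landau (ns-wall-eng-6 g4 `Homogeneous.steadyShellRigidity_of_homogeneous`, p711757).
HONEST FRAME: information-grade kernel typing of a print witness class (Šverák arXiv:math/0604550 §3–§4; Li–Li–Yan arXiv:1609.08197;
survey arXiv:2509.07243 §2.1.3) on an idea card strictly below W1; no wall stub touched; W1 movement 0; `PoloidalLiouville` (1222),
`SteadyShellRigidity` (C♯) off the homogeneous stratum and NS regularity are OPEN / NOT proved.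
-/

-- the summit and its single sub-problem share the name (CONVENTIONS §1)
set_option linter.dupNamespace false

noncomputable section

namespace Summit.NavierStokesRegularity.NavierStokesRegularity.Theorems.PoloidalLiouville.AzimuthalCartan

open Set Function Filter Topology Metric
open scoped ContDiff RealInnerProductSpace
open Literature.Analysis.FluidPDE
open Summit.NavierStokesRegularity.NavierStokesRegularity.Theorems.PoloidalLiouville.CentreJet (E3 IsSteadyNSOn)
open Summit.NavierStokesRegularity.NavierStokesRegularity.Theorems.RotatingEulerWindowProfileLinearRung
  (cross_apply_zero cross_apply_one cross_apply_two)
open Jordan (dx e dx_apply)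

namespace ConicalWitness

/-! ### Values at the centre `x₁ = (1,1,1)` -/

/-- `x₁ ∈ coneBall`. -/
theorem xOne_mem : xOne ∈ coneBall := mem_ball_self (by norm_num)

/-- `N(x₁) = 196`. -/
theorem quartN_xOne : quartN xOne = 196 := by simp [quartN]; norm_num

/-- `D(x₁) = 14`. -/
theorem quadD_xOne : quadD xOne = 14 := by simp [quadD]; norm_num

/-- `|x₁|² = 3`. -/
theorem norm_sq_xOne : ‖xOne‖ ^ 2 = 3 := by
  rw [EuclideanSpace.real_norm_sq_eq, Fin.sum_univ_three]
  simp
  norm_num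

/-- `e^{Φ(x₁)} = 1`. -/
theorem exp_potential_xOne : Real.exp (potential xOne) = 1 := by
  rw [exp_potential xOne_mem, quartN_xOne, quadD_xOne]; norm_num

/-- `h(x₁) = 0`. -/
theorem radialCoeff_xOne : radialCoeff potential xOne = 0 := by
  rw [radialCoeff, exp_potential_xOne]; norm_num

/-- `c(x₁) = 2e^{Φ}/|x₁|² = ⅔`. -/
theorem vortAmp_xOne : 2 * Real.exp (potential xOne) / ‖xOne‖ ^ 2 = 2 / 3 := by
  rw [exp_potential_xOne, norm_sq_xOne]; norm_num

/-- `g(x₁) = (−108, 36, 72)/49`. -/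
theorem grad_xOne_apply (i : Fin 3) : grad xOne i = ![-108 / 49, 36 / 49, 72 / 49] i := by
  fin_cases i <;> simp [grad, gradN_apply, gradD_apply, quartN_xOne, quadD_xOne] <;> norm_num

/-- `u(x₁) = g(x₁)` (`h(x₁) = 0`). -/
theorem conicalField_xOne_apply (i : Fin 3) : conicalField potential xOne i = ![-108 / 49, 36 / 49, 72 / 49] i := by
  rw [liouvilleCone.conicalField_eq xOne_mem, radialCoeff_xOne, zero_smul, add_zero, grad_xOne_apply]

/-- `H(x₁) v`, explicitly. -/
theorem hess_xOne_apply (v : E3) (i : Fin 3) :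
    hess xOne v i = ![(3204 * v 0 - 1488 * v 1 + 3576 * v 2) / 2401, (-1488 * v 0 + 1812 * v 1 - 2088 * v 2) / 2401,
      (3576 * v 0 - 2088 * v 1 - 5016 * v 2) / 2401] i := by
  have hin : ∀ a : E3, ⟪a, v⟫ = a 0 * v 0 + a 1 * v 1 + a 2 * v 2 := fun a => by
    simp only [PiLp.inner_apply, RCLike.inner_apply, conj_trivial, Fin.sum_univ_three]; ring
  fin_cases i <;>
    simp [hess, hessN_apply, hessD_apply, gradN_apply, gradD_apply, quartN_xOne, quadD_xOne, hin,
      ContinuousLinearMap.smulRight_apply, innerSL_apply_apply] <;> ring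

/-- `Dh(x₁) v = ⅔⟪g(x₁), v⟫`. -/
theorem dRadial_xOne (v : E3) : dRadial potential grad xOne v = 2 / 3 * ⟪grad xOne, v⟫ := by
  rw [dRadial_eq_innerSL, innerSL_apply_apply, vortAmp_xOne, radialCoeff_xOne, inner_sub_left, inner_smul_left, inner_smul_left]
  simp

/-- **`Du(x₁) v`, explicitly**: `H(x₁) v + ⅔⟪g(x₁), v⟫ x₁`. -/
theorem fderiv_xOne_apply (v : E3) (i : Fin 3) :
    fderiv ℝ (conicalField potential) xOne v i =
      ![(3204 * v 0 - 1488 * v 1 + 3576 * v 2) / 2401, (-1488 * v 0 + 1812 * v 1 - 2088 * v 2) / 2401,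
          (3576 * v 0 - 2088 * v 1 - 5016 * v 2) / 2401] i +
        2 / 3 * (-108 / 49 * v 0 + 36 / 49 * v 1 + 72 / 49 * v 2) := by
  have hin : ⟪grad xOne, v⟫ = -108 / 49 * v 0 + 36 / 49 * v 1 + 72 / 49 * v 2 := by
    simp only [PiLp.inner_apply, RCLike.inner_apply, conj_trivial, Fin.sum_univ_three, grad_xOne_apply]
    simp
    ring
  rw [liouvilleCone.fderiv_conicalField xOne_mem, dField_apply, hess_xOne_apply, radialCoeff_xOne, dRadial_xOne, hin, xOne_apply]
  ring

/-! ### `curl u (x₁) ≠ 0` -/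

/-- `curl u (x₁) = ⅔ (g(x₁) × x₁)`; its second component is `120/49`. -/
theorem curl_conicalField_xOne_apply_one : curl (conicalField potential) xOne 1 = 120 / 49 := by
  rw [liouvilleCone.curl_conicalField xOne_mem, vortAmp_xOne, PiLp.smul_apply, cross_apply_one, grad_xOne_apply, grad_xOne_apply,
    xOne_apply, xOne_apply]
  simp
  norm_num

/-- **`curl u (x₁) ≠ 0`**: the conical flow is not potential. -/
theorem curl_conicalField_xOne_ne_zero : curl (conicalField potential) xOne ≠ 0 := by
  intro h
  have h1 := congrArg (fun u : E3 => u 1) h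
  simp only [curl_conicalField_xOne_apply_one, PiLp.zero_apply] at h1
  norm_num at h1

/-! ### No symmetry axis -/

/-- ★ **No symmetry axis**: no non-zero skew `A` makes the conical flow infinitesimally `A`-equivariant about the vertex on the ball
(a fortiori none with constant swirl). -/
theorem noAxis :
    ¬ ∃ A : E3 →L[ℝ] E3, IsSkewAxis A ∧ IsEquivariantOn coneBall 0 A (conicalField potential) ∧
      HasConstantSwirlOn coneBall 0 A (conicalField potential) := by
  rintro ⟨A, ⟨hskew, hA0⟩, hE, -⟩
  obtain ⟨w, hw⟩ := SilentShells.TwoAxes.exists_cross_of_skew A (CrossFlow.skew_of_inner_self_eq_zero hskew)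
  have h := hE xOne xOne_mem
  rw [sub_zero, hw, hw] at h
  -- the three components of `Du(x₁)[w × x₁] = w × u(x₁)`
  have e0 := congrArg (fun u : E3 => u 0) h
  have e1 := congrArg (fun u : E3 => u 1) h
  have e2 := congrArg (fun u : E3 => u 2) h
  simp only [fderiv_xOne_apply, cross_apply_zero, cross_apply_one, cross_apply_two, conicalField_xOne_apply, xOne_apply, mul_one]
    at e0 e1 e2
  simp only [Matrix.cons_val_zero, Matrix.cons_val_one, Matrix.cons_val_two, Matrix.head_cons, Matrix.tail_cons] at e0 e1 e2
  have hw0 : w 0 = 0 := by linarith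
  have hw1 : w 1 = 0 := by linarith
  have hw2 : w 2 = 0 := by linarith
  apply hA0
  ext y i
  rw [hw]
  have hw' : w = 0 := by ext j; fin_cases j <;> simp [hw0, hw1, hw2]
  rw [hw']
  simp [cross, crossProduct]

/-! ### K♯ by name -/

/-- ★★★ **K♯ `PoloidalConicalFlows`** (sketch `AzimuthalCartanSketch` v1.3c / twin `ThreadingFluxAzimuthalCartanDefs` l.299) BY NAME:
there is an analytic steady Navier–Stokes flow on a ball (`conicalField Φ` on `ball (1,1,1) ½`, `e^{Φ} = N/D²`), `(−1)`-homogeneous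
and unthreaded about a point outside it (the vertex `0`), with `curl ≢ 0`, which is NOT infinitesimally axisymmetric with constant swirl
about any axis through that point.  Šverák's correspondence, constructive direction (`LiouvilleCone.correspondence`) + the rational
Liouville witness (`ConicalWitness.liouvilleCone`) + `curl ≠ 0` and NO AXIS at `(1,1,1)`. -/
theorem poloidalConicalFlows : PoloidalConicalFlows := by
  obtain ⟨hV, hp, hNS, hU, hH, -⟩ := liouvilleCone.correspondence
  exact ⟨conicalField potential, conicalPressure potential, 0, xOne, 1 / 2, by norm_num, hV, hp, hNS, hU,
    ⟨xOne, xOne_mem, curl_conicalField_xOne_ne_zero⟩, hH, noAxis⟩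

end ConicalWitness

/-- ★★★ K♯ BY NAME at the sketch's level: `AzimuthalCartan.poloidalConicalFlows : PoloidalConicalFlows`. -/
theorem poloidalConicalFlows : PoloidalConicalFlows := ConicalWitness.poloidalConicalFlows

end Summit.NavierStokesRegularity.NavierStokesRegularity.Theorems.PoloidalLiouville.AzimuthalCartan

end
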